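/-
Copyright (c) 2026 the pub-hodgecm-mathlib formalisation cell (harness21).  Prover seat hodgecm-mathlib-F0P2-p09 (g3), Track B «K2-LIT» helper hand,
#184♮ = hLiu418 = `stmt-HodgeConjecture-24832`; socket #41, KIND W, (iii-fin) letter (R) = (KW-fin-stab) «quantitative radius-stability»: the RADII EDITION of the
Φ5-tie twin ★ p864209 (architect K2E3-p06 (g7) 2026-09-05T01:39:50Z; KW desk F0P2-p08 (g4); LEAD F0P6-plan (g15)).  Sibling file rather than an append-only ED. 2 of
★ p864209 because the 400-line rule would be exceeded (★ p864209 = 313 l.).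
THEOREMS ONLY (no `def`, no `instance`, no notation, no named-fact hypothesis, no `sorry`).
-/
import Summits.HodgeConjecture.HodgeConjecture.Theorems.K2LiuBadPlaceWhittakerBallLevel        -- ★ p864209 (this seat): the Φ5-tie twin `whittaker_setIntegral_ball_eq_of_level` + translate layer
import Summits.HodgeConjecture.HodgeConjecture.Theorems.K2LiuBadPlaceWhittakerFarShellsRadii   -- ★ p864173 FILE 2′ (K2E3-p06): far shells dead beyond an EXPLICIT radius, no `∃`
import HarnessLib

/-!
# Crux `HLiu418`, socket #41, (KW-fin-stab) — `K2LiuBadPlaceWhittakerBallRadii`: KAREL'S LEMMA FOR A RIGHT TRANSLATE WITH A FULLY EXPLICIT RADIUS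
# (`max j₀ 0 + max j₁ 0 + |d| + 2|c_ε| + 2|c₂| + 2|b_T| + 2 + Σ_w M_w + 4b + 2b′`) — the `(hballM)` pair of the (R) pole with NO opaque constant

Cell `hodgecm-mathlib`, crux item hLiu418 = `stmt-HodgeConjecture-24832` (helper lane `--supports … --as helper`, count-neutral), route of record `HCCMUnconditional`;
squad K2 ∕ K2Liu (L1, LEAD F0P6-plan (g15)), road `K2_Liu`, socket #41, KIND W, (iii-fin) letter (R) `hstab` of ★ p863720 `K2LiuKindWFiniteSizeLetterOfPlace.hsizeLoc_of_place`.
THE (R) POLE (architect K2E3-p06 (g7), KW desk F0P2-p08 (g4) re-cut 01:23:54Z + note #1 01:33:21Z): ★ p864100 FILE 1 `K2LiuLocalLeviSupplyLevel` (Levi moves of principal level) →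
★ p864134 FILE 2 ∕ ★ p864173 FILE 2′ `setIntegral_farShell_eq_zero_of_radii` (far shells dead beyond an EXPLICIT radius, supply ∕ integrality letters `hsup hinv` at radii `j₀ j₁`
BY VALUE) → ★ p864209 TWIN `whittaker_setIntegral_ball_eq_of_level` (ball integrals of a right translate constant from `(K₀ + Σ_w M_w + 4b + 2b′ − 1)⁺`, `K₀` + the far-shell
letter BY VALUE) → THIS FILE: the composition, so that the (iii-fin) consumer (K2E3-p29 (g3)'s FILE 3 `hstab_of_letters`, then ★ p863720) receives the `(hballM)` pair with
EVERY constant a by-value letter of the place (`j₀ j₁ d c_ε c₂ b_T M b b′`) and NO `∃` — the point of architect note #1: off a finite set of places all of them vanish.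
* **`whittaker_setIntegral_ball_eq_of_radii`** — INPUT BY VALUE = ★ p864173's letters (`(j₀ hsup) (j₁ hinv)`, Tate's conductor exponent `d` of `ψ_{F,v} = adeleAddCharAt F v`,
  `ε hεσ hεint cε hε`, `c₂ h2`, `bT hTb hTib`, `ϖ hϖ`) + the twin's (`M`, Siegel `hf`, translate `x` with level letter `hfMx` in ★ p863964 §4's shape, `hfc hdiff hbd`, index letters);
  DISCHARGED INSIDE: `μF := addHaar`, `τ := Tr` (★ B3), ★ F3b's lattice facts; OUTPUT: ball-constancy from `(R − 1)⁺` and holomorphy at `B(−(R−1)⁺)`,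
  `R := max j₀ 0 + max j₁ 0 + |d| + 2|c_ε| + 2|c₂| + 2|b_T| + 2 + Σ_w M_w + 4b + 2b′`.
* (ED. 2) **`whittaker_setIntegral_ball_stable_of_radii`** — the STABILITY HALF ALONE with only `hfc` (no `hdiff`∕`hbd`; architect K2E3-p06 (g7) 01:47:20Z):
  `∀ s (k : ℤ), R ≤ k → ∫_{B(−k)} = ∫_{B(−R)}` (equality AT `R`, `k : ℤ`) — the inner bytes of K2E3-p29 (g3)'s FILE 3 `hballM` (SIG 01:46:09Z).
[Casselman1980, §3] [KudlaRallis1994, §2] [Shimura1997, §18.3–18.4] [PlatonovRapinchuk1994, §5.1] [CasselsFrohlichANT1967, Ch. XV §2.2].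
HONEST LABEL.  Count-neutral helper, closes no socket by itself: `HC_CM` is proved only modulo the 7 printed citations (2 remaining named inputs:
hLiu418 = `stmt-HodgeConjecture-24832`, h413 = `stmt-HodgeConjecture-24833`) until rung 0 closes.  The dischargers of `hsup`∕`hinv` with explicit `j₀ j₁`
(FILE 2b `K2LiuLocalLeviSupplyExplicit`, K2E3-p37 (g3)) are NOT here.

## References
* [Casselman1980] W. Casselman, *The unramified principal series of p-adic groups I*, Compositio Math. 40 (1980): §3.
* [KudlaRallis1994] S. Kudla, S. Rallis, *A regularized Siegel–Weil formula: the first term identity*, Ann. of Math. 140 (1994): §2.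
* [Shimura1997] G. Shimura, *Euler products and Eisenstein series*, CBMS 93 (1997): §18.3–18.4.
* [PlatonovRapinchuk1994] V. Platonov, A. Rapinchuk, *Algebraic Groups and Number Theory* (1994): §5.1.
* [CasselsFrohlichANT1967] J. Tate, in Cassels–Fröhlich (eds.), *Algebraic Number Theory* (1967): Ch. XV §2.2.
-/

set_option autoImplicit false
-- the mandated namespace repeats the single-problem summit's segment (`HodgeConjecture.HodgeConjecture`)
set_option linter.dupNamespace false

noncomputable section

open scoped Matrix NNReal ENNReal Topology MatrixGroups
open NumberField IsDedekindDomain MeasureTheory Measure Filter Set Metric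
open Literature.NumberTheory.Automorphic Literature.NumberTheory.Automorphic.UnitaryGroup Literature.NumberTheory.GaloisRepresentations
open Literature.NumberTheory.GelbartRogawski1991 Literature.NumberTheory.GelbartRogawski1991.AdaptedBlocks
open Literature.NumberTheory.GelbartRogawski1991.UnitaryDualPair
open Literature.NumberTheory.K2Lit Literature.NumberTheory.K2Lit.LocalSiegelDoubled
open Summit.HodgeConjecture.HodgeConjecture.Cruxes.HLiu418.K2LiuSkewLatticeShells (measurableSet_ball measure_ball_ne_top measure_ball_ne_zero preimage_ball_eq_of_integral)
open Summit.HodgeConjecture.HodgeConjecture.Cruxes.HLiu418.K2LiuTateCharacterLocalTrace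
open Summit.HodgeConjecture.HodgeConjecture.Cruxes.HLiu418.K2LiuBadPlaceWhittakerFarShellsRadii (setIntegral_farShell_eq_zero_of_radii)
open Summit.HodgeConjecture.HodgeConjecture.Cruxes.HLiu418.K2LiuBadPlaceWhittakerBallLevel (whittaker_setIntegral_ball_eq_of_level)

namespace Summit.HodgeConjecture.HodgeConjecture.Cruxes.HLiu418.K2LiuBadPlaceWhittakerBallRadii

variable (F : Type) [Field F] [NumberField F] (E : Type) [Field E] [NumberField E] [Algebra F E]
  [Algebra.IsQuadraticExtension F E] (c : E ≃ₐ[F] E)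
  {δ : E} (hcδ : c δ = -δ) (hδ : δ ≠ 0) {dd : F} (hd : δ * δ = algebraMap F E dd)
  (v : HeightOneSpectrum (𝓞 F)) (n : ℕ) {T₀ : Matrix (Fin n) (Fin n) F} (hT₀ : T₀.IsSymm) (hT₀d : IsUnit T₀.det)
  {JD : Matrix (Fin (n + n)) (Fin (n + n)) E} (hJD : JD = (LocalSplitting.gramD F n T₀).map (algebraMap F E))
  {π : v.adicCompletion F} (hπ : Valued.v π = WithZero.exp (-1 : ℤ))

/-! ## The radii edition: ★ p864173's explicit far-shell radius fed into §4 — no opaque constant left -/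

include hcδ hδ hd hT₀ hT₀d hJD hπ in
/-- **KAREL'S LEMMA FOR A RIGHT TRANSLATE WITH A FULLY EXPLICIT RADIUS — THE `(hballM)` PAIR, RADII EDITION** (architect K2E3-p06 (g7) 2026-09-05T01:39:50Z).  ★ p864209
`K2LiuBadPlaceWhittakerBallLevel.whittaker_setIntegral_ball_eq_of_level` at `K₀ := max j₀ 0 + max j₁ 0 + |d| + 2|c_ε| + 2|c₂| + 2|b_T| + 2`, its far-shell letter DISCHARGED by ★ p864173
`setIntegral_farShell_eq_zero_of_radii` — whose letters are taken BY VALUE here: the Levi-supply letter `hsup` at radius `j₀` and the integrality letter `hinv` at radius `j₁`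
(★ F3a's ∕ ★ F4b-1's shapes, per direction `single a b e`, `e ∈ {1, ε}`), Tate's conductor exponent `d` of `ψ_{F,v} = adeleAddCharAt F v` (`hdψ`), the skew unit `ε` (`hεσ hεint cε hε`),
the 2-adic depth `c₂` (`h2`), the Gram exponent `b_T` (`hTb hTib`), uniformisers `ϖ_w` (`hϖ`); then the level vector `M`, the family `f` (Siegel `hf`, continuous, entire, `hbd`), the
translate `x` with its level letter `hfMx`, and the index letters.  Discharged inside: `μF := addHaar`, `τ := Tr` (★ B3 `toLocalRing_algebraTrace` ∕ `algebraTrace_toLocalRing_mul` ∕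
`continuous_algebraTrace_localRing`), ★ F3b's lattice facts (`measurableSet_ball`, `measure_ball_ne_top`, `measure_ball_ne_zero`, `preimage_ball_eq_of_integral`).  OUTPUT: with
`R := max j₀ 0 + max j₁ 0 + |d| + 2|c_ε| + 2|c₂| + 2|b_T| + 2 + Σ_w M_w + 4b + 2b′`, the ball integrals `∫_{B(−k)} f s (w_Δ n(t) x)·ψ_{F,v}(−Tr tr(β t)) dμ` are constant for
`k ≥ (R − 1)⁺` and `s ↦ ∫_{B(−(R−1)⁺)} (same)` is entire — NO `∃`, every constant a letter of the place.
[cite: Casselman1980, §3] [cite: KudlaRallis1994, §2] [cite: Shimura1997, §18.3–18.4] [cite: PlatonovRapinchuk1994, §5.1] [cite: CasselsFrohlichANT1967, Ch. XV §2.2] -/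
theorem whittaker_setIntegral_ball_eq_of_radii (S : AddSubgroup (Matrix (Fin n) (Fin n) (LocalRing E v)))
    (hS : ∀ t, t ∈ S ↔ (t.map (conjLocal E c v))ᵀ * LocalSplitting.gramS F E v n T₀ + LocalSplitting.gramS F E v n T₀ * t = 0)
    [MeasurableSpace S] [BorelSpace S] [LocallyCompactSpace S] (μ : Measure S) [μ.IsAddHaarMeasure] [μ.Regular]
    {χv : ∀ w : UnitaryGroup.PlacesOver E v, (w.1.adicCompletion E)ˣ →* ℂˣ}
    -- Tate's conductor exponent, the skew unit, the 2-adic depth, the Gram exponent (BY VALUE)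
    {d : ℤ} (hdψ : (adeleAddCharAt F v).HasConductorExp d)
    {ε : LocalRing E v} (hεσ : conjLocal E c v ε = -ε) (hεint : ∀ w : UnitaryGroup.PlacesOver E v, Valued.v (ε w) ≤ 1) {cε c₂ bT : ℤ}
    (hε : ∀ w : UnitaryGroup.PlacesOver E v, Valued.v (UnitaryGroup.toPlace v w π) ^ cε ≤ Valued.v ((2 * ε) w))
    (h2 : ∀ w : UnitaryGroup.PlacesOver E v, Valued.v (UnitaryGroup.toPlace v w π) ^ c₂ ≤ Valued.v ((2 : LocalRing E v) w))
    (hTb : ∀ i j (w : UnitaryGroup.PlacesOver E v), Valued.v (LocalSplitting.gramS F E v n T₀ i j w) ≤ Valued.v (UnitaryGroup.toPlace v w π) ^ (-bT))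
    (hTib : ∀ i j (w : UnitaryGroup.PlacesOver E v), Valued.v ((LocalSplitting.gramS F E v n T₀)⁻¹ i j w) ≤ Valued.v (UnitaryGroup.toPlace v w π) ^ (-bT))
    -- the Levi-supply letter at radius `j₀` and the integrality letter at radius `j₁` (★ p864173's bytes)
    (j₀ : ℤ)
    (hsup : ∀ (a b : Fin n) (bb : Bool), ∀ z ∈ primePowBall (v.adicCompletion F) j₀, ∃ q : UnitaryGroup.localPi E c (n + n) JD v,
      blkC (LocalSplitting.matA F E c v n q) = 0 ∧ blkB (LocalSplitting.matA F E c v n q) = 0 ∧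
      blkA (LocalSplitting.matA F E c v n q) = 1 + toLocalRing E v z • Matrix.single a b (if bb then ε else (1 : LocalRing E v)) ∧
      (blkD (LocalSplitting.matA F E c v n q))⁻¹ = 1 + toLocalRing E v z •
        ((LocalSplitting.gramS F E v n T₀)⁻¹ * ((Matrix.single a b (if bb then ε else (1 : LocalRing E v))).map (conjLocal E c v))ᵀ * LocalSplitting.gramS F E v n T₀) ∧
      LocalSplitting.chiDet F E c v n χv (LocalSplitting.weylDelta F E c v n hJD * q * LocalSplitting.weylDelta F E c v n hJD) = 1 ∧
      absDetDelta F E c v n (LocalSplitting.weylDelta F E c v n hJD * q * LocalSplitting.weylDelta F E c v n hJD) = 1)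
    (j₁ : ℤ)
    (hinv : ∀ (a b : Fin n) (bb : Bool), ∀ z ∈ primePowBall (v.adicCompletion F) j₁,
      (∀ a' b' (w : UnitaryGroup.PlacesOver E v), Valued.v ((1 + toLocalRing E v z • Matrix.single a b (if bb then ε else (1 : LocalRing E v)))⁻¹ a' b' w) ≤
        Valued.v (UnitaryGroup.toPlace v w π) ^ (0 : ℤ)) ∧
      (∀ a' b' (w : UnitaryGroup.PlacesOver E v), Valued.v ((1 + toLocalRing E v z •
        ((LocalSplitting.gramS F E v n T₀)⁻¹ * ((Matrix.single a b (if bb then ε else (1 : LocalRing E v))).map (conjLocal E c v))ᵀ *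
          LocalSplitting.gramS F E v n T₀))⁻¹ a' b' w) ≤ Valued.v (UnitaryGroup.toPlace v w π) ^ (0 : ℤ)))
    -- uniformisers of the `E_w`
    {ϖ : (w : UnitaryGroup.PlacesOver E v) → w.1.adicCompletion E} (hϖ : ∀ w, Valued.v (ϖ w) = WithZero.exp (-1 : ℤ))
    -- the level vector, the family, the translate and its level letter, the regularity letters
    (M : UnitaryGroup.PlacesOver E v → ℕ) {f : ℂ → UnitaryGroup.localPi E c (n + n) JD v → ℂ}
    (hf : ∀ s, IsLocalSiegelSection F E c hcδ hδ hd v n hT₀ hJD χv s (f s)) (x : UnitaryGroup.localPi E c (n + n) JD v)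
    (hfMx : ∀ s g (k : UnitaryGroup.localPi E c (n + n) JD v),
      (∀ w : UnitaryGroup.PlacesOver E v, (k : UnitaryGroup.LocalGLPi E (n + n) v) w ∈
        congruenceGL (n + n) (ValuativeRel.valuation (w.1.adicCompletion E) (ϖ w) ^ M w)) → f s (g * k * x) = f s (g * x))
    (hfc : ∀ s, Continuous (f s)) (hdiff : ∀ g, Differentiable ℂ fun s => f s g)
    (hbd : ∀ Kc : Set (UnitaryGroup.localPi E c (n + n) JD v), IsCompact Kc → ∀ s₀ : ℂ, ∃ r > 0, ∃ C : ℝ, ∀ s ∈ Metric.ball s₀ r, ∀ g ∈ Kc, ‖f s g‖ ≤ C)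
    -- the index letters
    {b b' : ℤ} {β βinv : Matrix (Fin n) (Fin n) (LocalRing E v)} (hb : 0 ≤ b) (hb' : 0 ≤ b') (h2bT : 2 * bT ≤ b)
    (hβs : (β.map (conjLocal E c v))ᵀ * LocalSplitting.gramS F E v n T₀ + LocalSplitting.gramS F E v n T₀ * β = 0) (hββ : β * βinv = 1)
    (hβ : ∀ i j (w : UnitaryGroup.PlacesOver E v), Valued.v (β i j w) ≤ Valued.v (UnitaryGroup.toPlace v w π) ^ (-b))
    (hβinv : ∀ i j (w : UnitaryGroup.PlacesOver E v), Valued.v (βinv i j w) ≤ Valued.v (UnitaryGroup.toPlace v w π) ^ (-b')) :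
    (∀ (s : ℂ) (k : ℕ),
        (max j₀ 0 + max j₁ 0 + |d| + 2 * |cε| + 2 * |c₂| + 2 * |bT| + 2 + (∑ w : UnitaryGroup.PlacesOver E v, (M w : ℤ)) + 4 * b + 2 * b' - 1).toNat ≤ k →
        ∫ t in {t : S | ∀ i j (w : UnitaryGroup.PlacesOver E v), Valued.v (t.1 i j w) ≤ Valued.v (UnitaryGroup.toPlace v w π) ^ (-(k : ℤ))},
          f s (LocalSplitting.weylDelta F E c v n hJD * LocalSplitting.nElem F E c v n hJD t.1 ((hS t.1).1 t.2) * x) *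
            ((adeleAddCharAt F v (-(Algebra.trace (v.adicCompletion F) (LocalRing E v) (Matrix.trace (β * t.1)))) : Circle) : ℂ) ∂μ =
        ∫ t in {t : S | ∀ i j (w : UnitaryGroup.PlacesOver E v), Valued.v (t.1 i j w) ≤ Valued.v (UnitaryGroup.toPlace v w π) ^
            (-((max j₀ 0 + max j₁ 0 + |d| + 2 * |cε| + 2 * |c₂| + 2 * |bT| + 2 + (∑ w : UnitaryGroup.PlacesOver E v, (M w : ℤ)) + 4 * b + 2 * b' - 1).toNat : ℤ))},
          f s (LocalSplitting.weylDelta F E c v n hJD * LocalSplitting.nElem F E c v n hJD t.1 ((hS t.1).1 t.2) * x) *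
            ((adeleAddCharAt F v (-(Algebra.trace (v.adicCompletion F) (LocalRing E v) (Matrix.trace (β * t.1)))) : Circle) : ℂ) ∂μ) ∧
      Differentiable ℂ fun s : ℂ =>
        ∫ t in {t : S | ∀ i j (w : UnitaryGroup.PlacesOver E v), Valued.v (t.1 i j w) ≤ Valued.v (UnitaryGroup.toPlace v w π) ^
            (-((max j₀ 0 + max j₁ 0 + |d| + 2 * |cε| + 2 * |c₂| + 2 * |bT| + 2 + (∑ w : UnitaryGroup.PlacesOver E v, (M w : ℤ)) + 4 * b + 2 * b' - 1).toNat : ℤ))},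
          f s (LocalSplitting.weylDelta F E c v n hJD * LocalSplitting.nElem F E c v n hJD t.1 ((hS t.1).1 t.2) * x) *
            ((adeleAddCharAt F v (-(Algebra.trace (v.adicCompletion F) (LocalRing E v) (Matrix.trace (β * t.1)))) : Circle) : ℂ) ∂μ := by
  letI : MeasurableSpace (v.adicCompletion F) := borel _
  haveI : BorelSpace (v.adicCompletion F) := ⟨rfl⟩
  -- ★ p864173: the far shells of ANY level-`M` Siegel family are dead beyond the explicit radius (Tate's `ψ_{F,v}`, ★ B3's trace, `μF := addHaar`, ★ F3b lattice facts)
  have hfar := setIntegral_farShell_eq_zero_of_radii F E c hcδ hδ hd v n hT₀ hT₀d hJD hπ S hS μ MeasureTheory.Measure.addHaar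
    (continuous_adeleAddCharAt F v) hdψ (τ := fun z => Algebra.trace (v.adicCompletion F) (LocalRing E v) z)
    (toLocalRing_algebraTrace E v c hcδ hδ) (fun r r' => map_add _ r r') (algebraTrace_toLocalRing_mul E v) (continuous_algebraTrace_localRing E v)
    hεσ hεint hε h2 hTb hTib j₀ hsup j₁ hinv
    (fun a => measurableSet_ball F E v hπ n S a) (fun a => measure_ball_ne_top F E c v hπ n S hS μ a) (measure_ball_ne_zero F E c v hπ n S hS μ 0)
    (fun L A D' A' D'' hL hL' hA hD' hA' hD'' a => preimage_ball_eq_of_integral F E v hπ n S L hL hL' hA hD' hA' hD'' a) hϖ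
  -- ★ p864209 §4 at `K₀ := max j₀ 0 + max j₁ 0 + |d| + 2|c_ε| + 2|c₂| + 2|b_T| + 2`
  exact whittaker_setIntegral_ball_eq_of_level F E c hcδ hδ hd v n hT₀ hJD hπ S hS μ
    (max j₀ 0 + max j₁ 0 + |d| + 2 * |cε| + 2 * |c₂| + 2 * |bT| + 2) hfar M hf x hfMx hfc hdiff hbd hb hb' h2bT hβs hββ hβ hβinv


/-! ## (ED. 2) The stability half alone: only continuity of the sections, `k : ℤ`, equality AT the radius -/

open Summit.HodgeConjecture.HodgeConjecture.Cruxes.HLiu418.K2LiuSkewLatticeShells (isCompact_ball) in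
open Summit.HodgeConjecture.HodgeConjecture.Cruxes.HLiu418.K2LiuBadPlaceWhittakerBallLevel
  (isLocalSiegelSection_mul_right measurable_pullback_mul_right exists_bound_pullback_mul_right_of_isCompact setIntegral_ball_eq_of_farShell_letter) in
include hcδ hδ hd hT₀ hT₀d hJD hπ in
/-- **KAREL'S LEMMA FOR A RIGHT TRANSLATE WITH A FULLY EXPLICIT RADIUS — STABILITY HALF ONLY** (architect K2E3-p06 (g7) 2026-09-05T01:47:20Z; the inner bytes of
K2E3-p29 (g3)'s FILE 3 `hballM`).  Same BY-VALUE letters as `whittaker_setIntegral_ball_eq_of_radii` MINUS holomorphy (`hdiff`) and the compact bound (`hbd`): only continuity `hfc`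
of the sections is needed for stability.  With `R := max j₀ 0 + max j₁ 0 + |d| + 2|c_ε| + 2|c₂| + 2|b_T| + 2 + Σ_w M_w + 4b + 2b′`: for every `s` and every INTEGER `k ≥ R`,
`∫_{B(−k)} f s (w_Δ n(t) x)·ψ_{F,v}(−Tr tr(β t)) dμ = ∫_{B(−R)} (same)` — equality AT the radius (both sides equal the ball integral at `R − 1`: ★ p864173 at the translate through
★ p864209 §1, then ★ p864209 `setIntegral_ball_eq_of_farShell_letter` twice). [cite: Casselman1980, §3] [cite: KudlaRallis1994, §2] [cite: Shimura1997, §18.3–18.4] -/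
theorem whittaker_setIntegral_ball_stable_of_radii (S : AddSubgroup (Matrix (Fin n) (Fin n) (LocalRing E v)))
    (hS : ∀ t, t ∈ S ↔ (t.map (conjLocal E c v))ᵀ * LocalSplitting.gramS F E v n T₀ + LocalSplitting.gramS F E v n T₀ * t = 0)
    [MeasurableSpace S] [BorelSpace S] [LocallyCompactSpace S] (μ : Measure S) [μ.IsAddHaarMeasure] [μ.Regular]
    {χv : ∀ w : UnitaryGroup.PlacesOver E v, (w.1.adicCompletion E)ˣ →* ℂˣ}
    -- Tate's conductor exponent, the skew unit, the 2-adic depth, the Gram exponent (BY VALUE)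
    {d : ℤ} (hdψ : (adeleAddCharAt F v).HasConductorExp d)
    {ε : LocalRing E v} (hεσ : conjLocal E c v ε = -ε) (hεint : ∀ w : UnitaryGroup.PlacesOver E v, Valued.v (ε w) ≤ 1) {cε c₂ bT : ℤ}
    (hε : ∀ w : UnitaryGroup.PlacesOver E v, Valued.v (UnitaryGroup.toPlace v w π) ^ cε ≤ Valued.v ((2 * ε) w))
    (h2 : ∀ w : UnitaryGroup.PlacesOver E v, Valued.v (UnitaryGroup.toPlace v w π) ^ c₂ ≤ Valued.v ((2 : LocalRing E v) w))
    (hTb : ∀ i j (w : UnitaryGroup.PlacesOver E v), Valued.v (LocalSplitting.gramS F E v n T₀ i j w) ≤ Valued.v (UnitaryGroup.toPlace v w π) ^ (-bT))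
    (hTib : ∀ i j (w : UnitaryGroup.PlacesOver E v), Valued.v ((LocalSplitting.gramS F E v n T₀)⁻¹ i j w) ≤ Valued.v (UnitaryGroup.toPlace v w π) ^ (-bT))
    -- the Levi-supply letter at radius `j₀` and the integrality letter at radius `j₁` (★ p864173's bytes)
    (j₀ : ℤ)
    (hsup : ∀ (a b : Fin n) (bb : Bool), ∀ z ∈ primePowBall (v.adicCompletion F) j₀, ∃ q : UnitaryGroup.localPi E c (n + n) JD v,
      blkC (LocalSplitting.matA F E c v n q) = 0 ∧ blkB (LocalSplitting.matA F E c v n q) = 0 ∧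
      blkA (LocalSplitting.matA F E c v n q) = 1 + toLocalRing E v z • Matrix.single a b (if bb then ε else (1 : LocalRing E v)) ∧
      (blkD (LocalSplitting.matA F E c v n q))⁻¹ = 1 + toLocalRing E v z •
        ((LocalSplitting.gramS F E v n T₀)⁻¹ * ((Matrix.single a b (if bb then ε else (1 : LocalRing E v))).map (conjLocal E c v))ᵀ * LocalSplitting.gramS F E v n T₀) ∧
      LocalSplitting.chiDet F E c v n χv (LocalSplitting.weylDelta F E c v n hJD * q * LocalSplitting.weylDelta F E c v n hJD) = 1 ∧
      absDetDelta F E c v n (LocalSplitting.weylDelta F E c v n hJD * q * LocalSplitting.weylDelta F E c v n hJD) = 1)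
    (j₁ : ℤ)
    (hinv : ∀ (a b : Fin n) (bb : Bool), ∀ z ∈ primePowBall (v.adicCompletion F) j₁,
      (∀ a' b' (w : UnitaryGroup.PlacesOver E v), Valued.v ((1 + toLocalRing E v z • Matrix.single a b (if bb then ε else (1 : LocalRing E v)))⁻¹ a' b' w) ≤
        Valued.v (UnitaryGroup.toPlace v w π) ^ (0 : ℤ)) ∧
      (∀ a' b' (w : UnitaryGroup.PlacesOver E v), Valued.v ((1 + toLocalRing E v z •
        ((LocalSplitting.gramS F E v n T₀)⁻¹ * ((Matrix.single a b (if bb then ε else (1 : LocalRing E v))).map (conjLocal E c v))ᵀ *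
          LocalSplitting.gramS F E v n T₀))⁻¹ a' b' w) ≤ Valued.v (UnitaryGroup.toPlace v w π) ^ (0 : ℤ)))
    -- uniformisers of the `E_w`
    {ϖ : (w : UnitaryGroup.PlacesOver E v) → w.1.adicCompletion E} (hϖ : ∀ w, Valued.v (ϖ w) = WithZero.exp (-1 : ℤ))
    -- the level vector, the family (Siegel, CONTINUOUS only), the translate and its level letter
    (M : UnitaryGroup.PlacesOver E v → ℕ) {f : ℂ → UnitaryGroup.localPi E c (n + n) JD v → ℂ}
    (hf : ∀ s, IsLocalSiegelSection F E c hcδ hδ hd v n hT₀ hJD χv s (f s)) (x : UnitaryGroup.localPi E c (n + n) JD v)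
    (hfMx : ∀ s g (k : UnitaryGroup.localPi E c (n + n) JD v),
      (∀ w : UnitaryGroup.PlacesOver E v, (k : UnitaryGroup.LocalGLPi E (n + n) v) w ∈
        congruenceGL (n + n) (ValuativeRel.valuation (w.1.adicCompletion E) (ϖ w) ^ M w)) → f s (g * k * x) = f s (g * x))
    (hfc : ∀ s, Continuous (f s))
    -- the index letters
    {b b' : ℤ} {β βinv : Matrix (Fin n) (Fin n) (LocalRing E v)} (hb : 0 ≤ b) (hb' : 0 ≤ b') (h2bT : 2 * bT ≤ b)
    (hβs : (β.map (conjLocal E c v))ᵀ * LocalSplitting.gramS F E v n T₀ + LocalSplitting.gramS F E v n T₀ * β = 0) (hββ : β * βinv = 1)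
    (hβ : ∀ i j (w : UnitaryGroup.PlacesOver E v), Valued.v (β i j w) ≤ Valued.v (UnitaryGroup.toPlace v w π) ^ (-b))
    (hβinv : ∀ i j (w : UnitaryGroup.PlacesOver E v), Valued.v (βinv i j w) ≤ Valued.v (UnitaryGroup.toPlace v w π) ^ (-b')) :
    ∀ (s : ℂ) (k : ℤ), max j₀ 0 + max j₁ 0 + |d| + 2 * |cε| + 2 * |c₂| + 2 * |bT| + 2 + (∑ w : UnitaryGroup.PlacesOver E v, (M w : ℤ)) + 4 * b + 2 * b' ≤ k →
      ∫ t in {t : S | ∀ i j (w : UnitaryGroup.PlacesOver E v), Valued.v (t.1 i j w) ≤ Valued.v (UnitaryGroup.toPlace v w π) ^ (-k)},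
          f s (LocalSplitting.weylDelta F E c v n hJD * LocalSplitting.nElem F E c v n hJD t.1 ((hS t.1).1 t.2) * x) *
            ((adeleAddCharAt F v (-(Algebra.trace (v.adicCompletion F) (LocalRing E v) (Matrix.trace (β * t.1)))) : Circle) : ℂ) ∂μ =
        ∫ t in {t : S | ∀ i j (w : UnitaryGroup.PlacesOver E v), Valued.v (t.1 i j w) ≤ Valued.v (UnitaryGroup.toPlace v w π) ^
            (-(max j₀ 0 + max j₁ 0 + |d| + 2 * |cε| + 2 * |c₂| + 2 * |bT| + 2 + (∑ w : UnitaryGroup.PlacesOver E v, (M w : ℤ)) + 4 * b + 2 * b'))},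
          f s (LocalSplitting.weylDelta F E c v n hJD * LocalSplitting.nElem F E c v n hJD t.1 ((hS t.1).1 t.2) * x) *
            ((adeleAddCharAt F v (-(Algebra.trace (v.adicCompletion F) (LocalRing E v) (Matrix.trace (β * t.1)))) : Circle) : ℂ) ∂μ := by
  letI : MeasurableSpace (v.adicCompletion F) := borel _
  haveI : BorelSpace (v.adicCompletion F) := ⟨rfl⟩
  -- ★ p864173 at Tate's `ψ_{F,v}`, ★ B3's trace, `μF := addHaar`, ★ F3b lattice facts
  have hfar := setIntegral_farShell_eq_zero_of_radii F E c hcδ hδ hd v n hT₀ hT₀d hJD hπ S hS μ MeasureTheory.Measure.addHaar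
    (continuous_adeleAddCharAt F v) hdψ (τ := fun z => Algebra.trace (v.adicCompletion F) (LocalRing E v) z)
    (toLocalRing_algebraTrace E v c hcδ hδ) (fun r r' => map_add _ r r') (algebraTrace_toLocalRing_mul E v) (continuous_algebraTrace_localRing E v)
    hεσ hεint hε h2 hTb hTib j₀ hsup j₁ hinv
    (fun a => measurableSet_ball F E v hπ n S a) (fun a => measure_ball_ne_top F E c v hπ n S hS μ a) (measure_ball_ne_zero F E c v hπ n S hS μ 0)
    (fun L A D' A' D'' hL hL' hA hD' hA' hD'' a => preimage_ball_eq_of_integral F E v hπ n S L hL hL' hA hD' hA' hD'' a) hϖ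
  -- the far shells of the TRANSLATED family are dead beyond the explicit radius (★ p864209 §1 translate layer)
  have hshell : ∀ (s : ℂ) (k : ℤ),
      max j₀ 0 + max j₁ 0 + |d| + 2 * |cε| + 2 * |c₂| + 2 * |bT| + 2 + (∑ w : UnitaryGroup.PlacesOver E v, (M w : ℤ)) + 4 * b + 2 * b' ≤ k →
      ∫ t in {t : S | ∀ i j (w : UnitaryGroup.PlacesOver E v), Valued.v (t.1 i j w) ≤ Valued.v (UnitaryGroup.toPlace v w π) ^ (-k)} \
          {t : S | ∀ i j (w : UnitaryGroup.PlacesOver E v), Valued.v (t.1 i j w) ≤ Valued.v (UnitaryGroup.toPlace v w π) ^ (-k + 1)},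
        f s (LocalSplitting.weylDelta F E c v n hJD * LocalSplitting.nElem F E c v n hJD t.1 ((hS t.1).1 t.2) * x) *
          ((adeleAddCharAt F v (-(Algebra.trace (v.adicCompletion F) (LocalRing E v) (Matrix.trace (β * t.1)))) : Circle) : ℂ) ∂μ = 0 :=
    fun s k hk => hfar M (fun s g => f s (g * x)) (fun s => isLocalSiegelSection_mul_right F E c hcδ hδ hd v n hT₀ hJD (hf s) x)
      (fun s g k hk => hfMx s g k hk) (fun s => measurable_pullback_mul_right F E c v n hJD S hS (hfc s) x)
      (fun s k => by
        obtain ⟨C, hC⟩ := exists_bound_pullback_mul_right_of_isCompact F E c v n hJD S hS (hfc s) x (isCompact_ball F E c v hπ n S hS (-k))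
        exact ⟨C, fun t ht => hC t ht⟩)
      b b' β βinv hb hb' h2bT hβs hββ hβ hβinv k hk s
  -- the ball integrals are constant from `R − 1` on (★ p864209 §2): at `k` and at `R` both equal the one at `R − 1`
  intro s k hk
  have hk' := setIntegral_ball_eq_of_farShell_letter F E c v n hJD hπ S hS μ hfc x (continuous_adeleAddCharAt F v)
    (τ := fun z => Algebra.trace (v.adicCompletion F) (LocalRing E v) z) (continuous_algebraTrace_localRing E v) β hshell s (k := k) (by omega)
  have hR := setIntegral_ball_eq_of_farShell_letter F E c v n hJD hπ S hS μ hfc x (continuous_adeleAddCharAt F v)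
    (τ := fun z => Algebra.trace (v.adicCompletion F) (LocalRing E v) z) (continuous_algebraTrace_localRing E v) β hshell s
    (k := max j₀ 0 + max j₁ 0 + |d| + 2 * |cε| + 2 * |c₂| + 2 * |bT| + 2 + (∑ w : UnitaryGroup.PlacesOver E v, (M w : ℤ)) + 4 * b + 2 * b') (by omega)
  exact hk'.trans hR.symm

end Summit.HodgeConjecture.HodgeConjecture.Cruxes.HLiu418.K2LiuBadPlaceWhittakerBallRadii

end
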